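import Summits.AtomisticToContinuum.FouriersLaw.Theorems.ClosedConeSensitivity.Negative.ZeroFrictionDictionary

/-!
# `ClosedConeSensitivity` / Negative (2/2): E3 is a bound on the mean-square TANGENT map

Negative-side support for crux `stmt-AtomisticToContinuum-14059`
(`OddSectorIrreversibility.ClosedConeSensitivity`, "E3", rank 4), from the standing disprover's
work file `Cruxes/ClosedConeSensitivity/Disproof.lean` §3 (+ the edge corollary), all sorry-free. Nothing here closes
the item and no Theses statement is asserted positively.

* §3 THE REDUCTION `tangentBoundAt_of_closedConeSensitivity : E3 → ∃ a κ C, TangentBoundAt …`: because the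
  bound carries `s²` for every `s ∈ (0,1]`, Fatou along `s = 1/(n+1)` gives the same cone bound for
  the Gibbs mean square of `liminf_n ((n+1)Δ_{1/(n+1)}(j_i∘Φ_t))²`, i.e. of the tangent-map entry
  `∂_{p_b}(j_i∘Φ_t)` wherever it exists: any proof of E3 bounds the mean-square TANGENT dynamics —
  finite differences buy no "bounded gain from rare hot corridors" (the crux docstring's hope).
  Ingredients: `|j_i∘Φ_t| ≤ N(3+β)/2·(1+H)²` (`abs_bondCurrent_detFlow_le`), `H(q, p+se_b) ≤ 2H + s²`
  (`hamiltonian_kick_le`), integrability of `(1+H)⁴e^{-H/T}` and of the squared finite difference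
  (`integrable_sqDiff`).
* §4 THE EDGE CONSEQUENCE `edgeBound_of_closedConeSensitivity`: `E3` bounds the normalised tangent
  mean square ON the cone boundary `t = a·d` uniformly in `N` and `d` — the prediction the kit jobs
  test (`M2(d, a·d)` against `d`). The refutation interface (`TangentRayBlowup ⇒ ¬E3`, a conditional
  refutation) and the hot-cluster intermittency heuristic predicting ray blow-up at every slope stay
  in the disprover's work file `Cruxes/ClosedConeSensitivity/Disproof.lean` §2/§4.
-/

noncomputable section

namespace Summit.AtomisticToContinuum.FouriersLaw.Theorems.ClosedConeSensitivity.Negative.TangentReduction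

open MeasureTheory Filter Topology ProbabilityTheory
open scoped NNReal ENNReal
open Literature.MathematicalPhysics.KineticTheory.HeatConduction
open Literature.Probability.Process
open Summit.AtomisticToContinuum.FouriersLaw.Theses.OddSectorIrreversibility
open Summit.AtomisticToContinuum.FouriersLaw.Theorems.ClosedConeSensitivity.Negative.ZeroFrictionDictionary

variable {ω₂ lam β : ℝ} (hω : 0 < ω₂) (hl : 0 ≤ lam) (hβ : 0 ≤ β)
include hω hl hβ

/-! ## §3 the load-bearing observation: `E3` is a bound on the mean-square TANGENT map

`E3` carries the factor `s²` for EVERY `s ∈ (0,1]`. Dividing by `s²` and letting `s = 1/(n+1) → 0`,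
Fatou's lemma turns `E3` into an `N`-uniform bound on `∫ liminf_n ((n+1) Δ_{1/(n+1)} (j_i∘Φ_t))² dμ_T`,
i.e. (wherever `p_b ↦ j_i(Φ_t(q, p))` is differentiable — everywhere, the flow of a polynomial field
being smooth, a fact not needed below) on `∫ (∂_{p_b}(j_i∘Φ_t))² dμ_T`, the Gibbs mean square of ONE
ENTRY OF THE TANGENT MAP `DΦ_t`. So "finite differences, hence bounded gain from rare hot corridors"
(the crux docstring) buys nothing: every proof of `E3` proves the tangent bound `TangentBoundAt`,
and every violation of the tangent bound refutes `E3`. -/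

/-- The **mean-square tangent cone bound** at fixed parameters and constants `(a, κ, C)` (Fatou
form, no differentiability needed): the body of `E3` with the integrand replaced by
`liminf_{n→∞} (n+1)² (j_i(Φ_t(q, p + e_b/(n+1))) - j_i(Φ_t(q,p)))²`, which is
`(∂_{p_b} (j_i ∘ Φ_t))²` at every point of differentiability. [folklore] -/
def TangentBoundAt (ω₂ lam β γ T a κ C : ℝ) : Prop :=
    ∀ (N : ℕ) (i b : Fin N) (t : ℝ), (b.val = 0 ∨ b.val = N - 1) → 0 ≤ t →
      let P := pinnedChain ω₂ lam β γ
      let μT : Measure (PhaseSpace N) :=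
        volume.withDensity (fun x => ENNReal.ofReal (Real.exp (-(P.hamiltonian N x) / T)))
      let d : ℕ := (if b.val = 0 then i.val else N - 2 - i.val)
      t ≤ a * (d : ℝ) →
        ∫⁻ x, Filter.liminf (fun n : ℕ => ENNReal.ofReal (((n : ℝ) + 1) ^ 2 *
            (P.bondCurrent N i (detFlow ω₂ lam β N t (x.1, Function.update x.2 b (x.2 b + 1 / ((n : ℝ) + 1)))) -
              P.bondCurrent N i (detFlow ω₂ lam β N t x)) ^ 2)) Filter.atTop ∂μT
          ≤ ENNReal.ofReal (C * Real.exp (-(κ * ((d : ℝ) - t / a))) *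
              ∫ x, Real.exp (-(P.hamiltonian N x) / T) ∂volume)

/-- Polynomial energy bound for the current transported along the closed flow:
`|j_i(Φ_t y)| ≤ N (3+β)/2 (1 + H(y))²` (energy conservation + `pinnedChain_abs_bondCurrent_le`). [folklore] -/
theorem abs_bondCurrent_detFlow_le (γ : ℝ) (N : ℕ) (i : Fin N) {t : ℝ} (ht : 0 ≤ t) (y : PhaseSpace N) :
    |(pinnedChain ω₂ lam β γ).bondCurrent N i (detFlow ω₂ lam β N t y)| ≤
      N * ((3 + β) / 2 * (1 + (pinnedChain ω₂ lam β γ).hamiltonian N y) ^ 2) := by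
  have h := pinnedChain_abs_bondCurrent_le hω.le hl hβ (0 : ℝ) N i (detFlow ω₂ lam β N t y)
  rw [hamiltonian_detFlow hω hl hβ N ht y] at h
  rw [bondCurrent_indep_friction, hamiltonian_indep_friction]
  exact h

omit hω hl hβ in
/-- A momentum kick is an added unit vector. [folklore] -/
theorem update_eq_add_single {N : ℕ} (p : Fin N → ℝ) (b : Fin N) (s : ℝ) :
    Function.update p b (p b + s) = p + Pi.single b s := by
  funext i
  by_cases h : i = b
  · subst h; simp
  · simp [Function.update_of_ne h, Pi.single_eq_of_ne h]

/-- Energy of the kicked state: `H(q, p + s e_b) = H(q,p) + p_b s + s²/2 ≤ 2 H(q,p) + s²`. [folklore] -/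
theorem hamiltonian_kick_le (γ : ℝ) (N : ℕ) (x : PhaseSpace N) (b : Fin N) (s : ℝ) :
    (pinnedChain ω₂ lam β γ).hamiltonian N (x.1, Function.update x.2 b (x.2 b + s)) ≤
      2 * (pinnedChain ω₂ lam β γ).hamiltonian N x + s ^ 2 := by
  rw [update_eq_add_single, (pinnedChain ω₂ lam β γ).hamiltonian_add_momentum N x (Pi.single b s)]
  have hsum : ∑ i, (x.2 i * (Pi.single b s : Fin N → ℝ) i + (Pi.single b s : Fin N → ℝ) i ^ 2 / 2) =
      x.2 b * s + s ^ 2 / 2 := by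
    rw [Finset.sum_eq_single b]
    · simp
    · intro i _ hi; simp [Pi.single_eq_of_ne hi]
    · intro h; exact absurd (Finset.mem_univ _) h
  rw [hsum]
  have hp : x.2 b ^ 2 ≤ 2 * (pinnedChain ω₂ lam β γ).hamiltonian N x :=
    le_trans (Finset.single_le_sum (f := fun i => x.2 i ^ 2) (fun i _ => sq_nonneg _) (Finset.mem_univ b))
      (pinnedChain_sum_sq_le_two_mul_hamiltonian hω hl hβ N x)
  nlinarith [sq_nonneg (x.2 b - s)]

/-- `(1 + H)⁴ e^{-H/T}` is Lebesgue integrable on phase space (Gaussian confinement). [folklore] -/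
theorem integrable_one_add_hamiltonian_pow_four_mul_exp (γ : ℝ) (N : ℕ) {T : ℝ} (hT : 0 < T) :
    Integrable fun x : PhaseSpace N => (1 + (pinnedChain ω₂ lam β γ).hamiltonian N x) ^ 4 *
      Real.exp (-((pinnedChain ω₂ lam β γ).hamiltonian N x) / T) := by
  set H := (pinnedChain ω₂ lam β γ).hamiltonian N with hH
  have hc : 0 < T⁻¹ / 4 := by positivity
  have hc2 : 0 < T⁻¹ / 2 := by positivity
  set K : ℝ := 2 * Real.exp (T⁻¹ / 4) / (T⁻¹ / 4) ^ 2 with hK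
  have hmaj := (pinnedChain_integrable_exp_neg_mul_hamiltonian hω hl hβ γ N hc2).const_mul (K ^ 2)
  have hcont : Continuous H := (pinnedChain_contDiff_hamiltonian ω₂ lam β γ N (n := 0)).continuous
  refine hmaj.mono' ?_ (Filter.Eventually.of_forall fun x => ?_)
  · have h1 : Continuous fun x : PhaseSpace N => (1 + H x) ^ 4 * Real.exp (-(H x) / T) := by
      have := hcont
      fun_prop
    exact h1.aestronglyMeasurable
  · have hH0 : 0 ≤ H x := pinnedChain_hamiltonian_nonneg hω.le hl hβ γ N x
    have hsq := one_add_sq_le_exp hH0 hc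
    have hK0 : 0 ≤ K := by positivity
    rw [Real.norm_eq_abs, abs_of_nonneg (by positivity)]
    have h4 : (1 + H x) ^ 4 ≤ K ^ 2 * Real.exp (T⁻¹ / 2 * H x) := by
      have : (1 + H x) ^ 4 = ((1 + H x) ^ 2) ^ 2 := by ring
      rw [this]
      calc ((1 + H x) ^ 2) ^ 2 ≤ (K * Real.exp (T⁻¹ / 4 * H x)) ^ 2 :=
            pow_le_pow_left₀ (by positivity) hsq 2
        _ = K ^ 2 * Real.exp (T⁻¹ / 2 * H x) := by
            rw [mul_pow, ← Real.exp_nat_mul]; congr 1; congr 1; push_cast; ring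
    calc (1 + H x) ^ 4 * Real.exp (-H x / T)
        ≤ K ^ 2 * Real.exp (T⁻¹ / 2 * H x) * Real.exp (-H x / T) :=
          mul_le_mul_of_nonneg_right h4 (Real.exp_pos _).le
      _ = K ^ 2 * Real.exp (-(T⁻¹ / 2 * H x)) := by
          rw [mul_assoc, ← Real.exp_add]; congr 1; congr 1; field_simp; ring


omit hω hl hβ in
/-- The kick map `x ↦ (q, p + s e_b)` is continuous. [folklore] -/
theorem continuous_kick {N : ℕ} (b : Fin N) (s : ℝ) :
    Continuous fun x : PhaseSpace N => (x.1, Function.update x.2 b (x.2 b + s)) := by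
  have h : (fun x : PhaseSpace N => (x.1, Function.update x.2 b (x.2 b + s))) =
      fun x => (x.1, x.2 + Pi.single b s) := funext fun x => by rw [update_eq_add_single]
  rw [h]
  fun_prop

/-- The squared finite difference of the transported current is continuous in the initial point. [folklore] -/
theorem continuous_sqDiff (γ : ℝ) (N : ℕ) (i b : Fin N) (t s : ℝ) :
    Continuous fun x : PhaseSpace N =>
      ((pinnedChain ω₂ lam β γ).bondCurrent N i (detFlow ω₂ lam β N t (x.1, Function.update x.2 b (x.2 b + s))) -
        (pinnedChain ω₂ lam β γ).bondCurrent N i (detFlow ω₂ lam β N t x)) ^ 2 := by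
  have hj := pinnedChain_continuous_bondCurrent ω₂ lam β γ N i
  have hΦ := continuous_detFlow hω hl hβ N t
  have hk := continuous_kick (N := N) b s
  exact ((hj.comp (hΦ.comp hk)).sub (hj.comp hΦ)).pow 2

/-- Pointwise majorant: `(Δ_s (j_i∘Φ_t))² ≤ 34 M² (1 + H)⁴`, `M = N(3+β)/2`, for `0 ≤ s ≤ 1`. [folklore] -/
theorem sqDiff_le (γ : ℝ) (N : ℕ) (i b : Fin N) {t : ℝ} (ht : 0 ≤ t) {s : ℝ} (hs0 : 0 ≤ s) (hs1 : s ≤ 1)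
    (x : PhaseSpace N) :
    ((pinnedChain ω₂ lam β γ).bondCurrent N i (detFlow ω₂ lam β N t (x.1, Function.update x.2 b (x.2 b + s))) -
        (pinnedChain ω₂ lam β γ).bondCurrent N i (detFlow ω₂ lam β N t x)) ^ 2 ≤
      34 * (N * ((3 + β) / 2)) ^ 2 * (1 + (pinnedChain ω₂ lam β γ).hamiltonian N x) ^ 4 := by
  set P := pinnedChain ω₂ lam β γ
  set y : PhaseSpace N := (x.1, Function.update x.2 b (x.2 b + s))
  set A := P.bondCurrent N i (detFlow ω₂ lam β N t y)
  set B := P.bondCurrent N i (detFlow ω₂ lam β N t x)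
  set M : ℝ := N * ((3 + β) / 2)
  have hH0 : 0 ≤ P.hamiltonian N x := pinnedChain_hamiltonian_nonneg hω.le hl hβ γ N x
  have hHy0 : 0 ≤ P.hamiltonian N y := pinnedChain_hamiltonian_nonneg hω.le hl hβ γ N y
  have hA : |A| ≤ M * (1 + P.hamiltonian N y) ^ 2 := by
    have := abs_bondCurrent_detFlow_le hω hl hβ γ N i ht y
    simpa [M, mul_assoc] using this
  have hB : |B| ≤ M * (1 + P.hamiltonian N x) ^ 2 := by
    have := abs_bondCurrent_detFlow_le hω hl hβ γ N i ht x
    simpa [M, mul_assoc] using this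
  have hy : 1 + P.hamiltonian N y ≤ 2 * (1 + P.hamiltonian N x) := by
    have := hamiltonian_kick_le hω hl hβ γ N x b s
    have hs2 : s ^ 2 ≤ 1 := by nlinarith
    simp only [y] at this ⊢
    linarith
  have hM : 0 ≤ M := by positivity
  have hA2 : A ^ 2 ≤ M ^ 2 * (2 * (1 + P.hamiltonian N x)) ^ 4 := by
    have h1 : A ^ 2 ≤ (M * (1 + P.hamiltonian N y) ^ 2) ^ 2 := by
      rw [← sq_abs A]; exact pow_le_pow_left₀ (abs_nonneg _) hA 2
    have h2 : (1 + P.hamiltonian N y) ^ 2 ≤ (2 * (1 + P.hamiltonian N x)) ^ 2 :=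
      pow_le_pow_left₀ (by linarith) hy 2
    calc A ^ 2 ≤ (M * (1 + P.hamiltonian N y) ^ 2) ^ 2 := h1
      _ = M ^ 2 * ((1 + P.hamiltonian N y) ^ 2) ^ 2 := by ring
      _ ≤ M ^ 2 * ((2 * (1 + P.hamiltonian N x)) ^ 2) ^ 2 := by
          gcongr
      _ = M ^ 2 * (2 * (1 + P.hamiltonian N x)) ^ 4 := by ring
  have hB2 : B ^ 2 ≤ M ^ 2 * (1 + P.hamiltonian N x) ^ 4 := by
    have h1 : B ^ 2 ≤ (M * (1 + P.hamiltonian N x) ^ 2) ^ 2 := by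
      rw [← sq_abs B]; exact pow_le_pow_left₀ (abs_nonneg _) hB 2
    calc B ^ 2 ≤ (M * (1 + P.hamiltonian N x) ^ 2) ^ 2 := h1
      _ = M ^ 2 * (1 + P.hamiltonian N x) ^ 4 := by ring
  have hAB : (A - B) ^ 2 ≤ 2 * A ^ 2 + 2 * B ^ 2 := by nlinarith [sq_nonneg (A + B)]
  calc (A - B) ^ 2 ≤ 2 * A ^ 2 + 2 * B ^ 2 := hAB
    _ ≤ 2 * (M ^ 2 * (2 * (1 + P.hamiltonian N x)) ^ 4) + 2 * (M ^ 2 * (1 + P.hamiltonian N x) ^ 4) := by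
        gcongr
    _ = 34 * M ^ 2 * (1 + P.hamiltonian N x) ^ 4 := by ring

/-- The squared finite difference is integrable against the (unnormalised) Gibbs weight. [folklore] -/
theorem integrable_sqDiff (γ : ℝ) (N : ℕ) (i b : Fin N) {t : ℝ} (ht : 0 ≤ t) {s : ℝ} (hs0 : 0 ≤ s)
    (hs1 : s ≤ 1) {T : ℝ} (hT : 0 < T) :
    Integrable (fun x : PhaseSpace N =>
      ((pinnedChain ω₂ lam β γ).bondCurrent N i (detFlow ω₂ lam β N t (x.1, Function.update x.2 b (x.2 b + s))) -
        (pinnedChain ω₂ lam β γ).bondCurrent N i (detFlow ω₂ lam β N t x)) ^ 2)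
      (volume.withDensity fun x : PhaseSpace N =>
        ENNReal.ofReal (Real.exp (-((pinnedChain ω₂ lam β γ).hamiltonian N x) / T))) := by
  set P := pinnedChain ω₂ lam β γ
  have hHc : Continuous (P.hamiltonian N) := (pinnedChain_contDiff_hamiltonian ω₂ lam β γ N (n := 0)).continuous
  have hρm : Measurable fun x : PhaseSpace N => ENNReal.ofReal (Real.exp (-(P.hamiltonian N x) / T)) := by
    fun_prop
  rw [integrable_withDensity_iff_integrable_smul' hρm (Filter.Eventually.of_forall fun _ => ENNReal.ofReal_lt_top)]
  have hG := continuous_sqDiff hω hl hβ γ N i b t s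
  refine ((integrable_one_add_hamiltonian_pow_four_mul_exp hω hl hβ γ N hT).const_mul
    (34 * (N * ((3 + β) / 2)) ^ 2)).mono' ?_ (Filter.Eventually.of_forall fun x => ?_)
  · refine (Continuous.aestronglyMeasurable ?_)
    have h1 : Continuous fun x : PhaseSpace N => (ENNReal.ofReal (Real.exp (-(P.hamiltonian N x) / T))).toReal := by
      have : (fun x : PhaseSpace N => (ENNReal.ofReal (Real.exp (-(P.hamiltonian N x) / T))).toReal) =
          fun x => Real.exp (-(P.hamiltonian N x) / T) :=
        funext fun x => ENNReal.toReal_ofReal (Real.exp_pos _).le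
      rw [this]; fun_prop
    exact h1.smul hG
  · rw [ENNReal.toReal_ofReal (Real.exp_pos _).le, smul_eq_mul, Real.norm_eq_abs, abs_mul,
      abs_of_pos (Real.exp_pos _), abs_of_nonneg (sq_nonneg _)]
    have hb := sqDiff_le hω hl hβ γ N i b ht hs0 hs1 x
    have he : 0 < Real.exp (-(P.hamiltonian N x) / T) := Real.exp_pos _
    calc Real.exp (-(P.hamiltonian N x) / T) * _ ≤
        Real.exp (-(P.hamiltonian N x) / T) * (34 * (N * ((3 + β) / 2)) ^ 2 * (1 + P.hamiltonian N x) ^ 4) :=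
          mul_le_mul_of_nonneg_left hb he.le
      _ = 34 * (N * ((3 + β) / 2)) ^ 2 * ((1 + P.hamiltonian N x) ^ 4 * Real.exp (-(P.hamiltonian N x) / T)) := by
          ring

omit hω hl hβ in
/-- **`E3` ⇒ the mean-square tangent cone bound** (Fatou along `s = 1/(n+1) → 0`). Any proof of
`ClosedConeSensitivity` is a proof of `TangentBoundAt`; any `N`-non-uniformity of the Gibbs
mean square of the tangent-map entry `∂_{p_b}(j_i∘Φ_t)` on the cone `t ≤ a d` refutes `E3`. [folklore] -/
theorem tangentBoundAt_of_closedConeSensitivity (hE3 : ClosedConeSensitivity) :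
    ∀ ω₂ lam β γ : ℝ, 0 < ω₂ → 0 < lam → 0 < β → 0 < γ → ∀ T : ℝ, 0 < T →
      ∃ a κ C : ℝ, 0 < a ∧ 0 < κ ∧ TangentBoundAt ω₂ lam β γ T a κ C := by
  intro ω₂ lam β γ hω hl hβ hγ T hT
  obtain ⟨a, κ, C, ha, hκ, H⟩ := (closedConeSensitivity_iff_det.mp hE3) ω₂ lam β γ hω hl hβ hγ T hT
  unfold ConeBoundAt at H
  refine ⟨a, κ, C, ha, hκ, ?_⟩
  unfold TangentBoundAt
  intro N i b t hb ht P μT d htd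
  have hn : ∀ n : ℕ,
      ∫⁻ x, ENNReal.ofReal (((n : ℝ) + 1) ^ 2 *
          (P.bondCurrent N i (detFlow ω₂ lam β N t (x.1, Function.update x.2 b (x.2 b + 1 / ((n : ℝ) + 1)))) -
            P.bondCurrent N i (detFlow ω₂ lam β N t x)) ^ 2) ∂μT
        ≤ ENNReal.ofReal (C * Real.exp (-(κ * ((d : ℝ) - t / a))) *
            ∫ x, Real.exp (-(P.hamiltonian N x) / T) ∂volume) := by
    intro n
    have hn0 : (0 : ℝ) < (n : ℝ) + 1 := by positivity
    have hs0 : (0 : ℝ) < 1 / ((n : ℝ) + 1) := by positivity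
    have hs1 : 1 / ((n : ℝ) + 1) ≤ 1 := by
      rw [div_le_one hn0]; linarith [n.cast_nonneg (α := ℝ)]
    have HE := H N i b t (1 / ((n : ℝ) + 1)) hb ht hs0 hs1 htd
    have hint := integrable_sqDiff hω hl.le hβ.le γ N i b ht hs0.le hs1 hT
    have hnn : 0 ≤ᵐ[μT] fun x => ((n : ℝ) + 1) ^ 2 *
        (P.bondCurrent N i (detFlow ω₂ lam β N t (x.1, Function.update x.2 b (x.2 b + 1 / ((n : ℝ) + 1)))) -
          P.bondCurrent N i (detFlow ω₂ lam β N t x)) ^ 2 :=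
      Filter.Eventually.of_forall fun x => by positivity
    rw [← ofReal_integral_eq_lintegral_ofReal (hint.const_mul _) hnn, integral_const_mul]
    apply ENNReal.ofReal_le_ofReal
    calc ((n : ℝ) + 1) ^ 2 * _ ≤ ((n : ℝ) + 1) ^ 2 * (C * (1 / ((n : ℝ) + 1)) ^ 2 *
          Real.exp (-(κ * ((d : ℝ) - t / a))) * ∫ x, Real.exp (-(P.hamiltonian N x) / T) ∂volume) :=
          mul_le_mul_of_nonneg_left HE (by positivity)
      _ = C * Real.exp (-(κ * ((d : ℝ) - t / a))) * ∫ x, Real.exp (-(P.hamiltonian N x) / T) ∂volume := by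
          field_simp
  have hmeas : ∀ n : ℕ, Measurable fun x : PhaseSpace N => ENNReal.ofReal (((n : ℝ) + 1) ^ 2 *
      (P.bondCurrent N i (detFlow ω₂ lam β N t (x.1, Function.update x.2 b (x.2 b + 1 / ((n : ℝ) + 1)))) -
        P.bondCurrent N i (detFlow ω₂ lam β N t x)) ^ 2) := fun n =>
    ((continuous_const.mul (continuous_sqDiff hω hl.le hβ.le γ N i b t (1 / ((n : ℝ) + 1)))).measurable).ennreal_ofReal
  calc _ ≤ Filter.liminf (fun n : ℕ => ∫⁻ x, ENNReal.ofReal (((n : ℝ) + 1) ^ 2 *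
          (P.bondCurrent N i (detFlow ω₂ lam β N t (x.1, Function.update x.2 b (x.2 b + 1 / ((n : ℝ) + 1)))) -
            P.bondCurrent N i (detFlow ω₂ lam β N t x)) ^ 2) ∂μT) Filter.atTop :=
        lintegral_liminf_le hmeas
    _ ≤ _ := Filter.liminf_le_of_frequently_le' (Filter.Eventually.of_forall hn).frequently


/-! ## §4 the edge consequence (the falsifiable prediction of `E3`) -/

omit hl hβ in
/-- **The edge consequence.** `E3` bounds the normalised tangent mean square ON the cone boundary
`t = a·d` uniformly in the chain length and in the bond: `∃ a C, ∀ N d,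
∫ liminf_n ((n+1)Δ_{1/(n+1)}(j_d∘Φ_{ad}))² e^{-H/T} ≤ C·Z_N` (kick at the left contact). This is the
single most falsifiable prediction of `E3` (kit jobs: `M2(d, a·d)` against `d`). [folklore] -/
theorem edgeBound_of_closedConeSensitivity (hE3 : ClosedConeSensitivity) {γ T : ℝ} (hγ : 0 < γ)
    (hl' : 0 < lam) (hβ' : 0 < β) (hT : 0 < T) :
    ∃ a C : ℝ, 0 < a ∧ ∀ (N : ℕ) (i b : Fin N), b.val = 0 →
      ∫⁻ x, Filter.liminf (fun n : ℕ => ENNReal.ofReal (((n : ℝ) + 1) ^ 2 *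
          ((pinnedChain ω₂ lam β 0).bondCurrent N i
              (detFlow ω₂ lam β N (a * i.val) (x.1, Function.update x.2 b (x.2 b + 1 / ((n : ℝ) + 1)))) -
            (pinnedChain ω₂ lam β 0).bondCurrent N i (detFlow ω₂ lam β N (a * i.val) x)) ^ 2)) Filter.atTop
        ∂(volume.withDensity fun x : PhaseSpace N =>
            ENNReal.ofReal (Real.exp (-((pinnedChain ω₂ lam β 0).hamiltonian N x) / T)))
      ≤ ENNReal.ofReal (C * ∫ x, Real.exp (-((pinnedChain ω₂ lam β 0).hamiltonian N x) / T) ∂volume) := by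
  obtain ⟨a, κ, C, ha, hκ, H⟩ := tangentBoundAt_of_closedConeSensitivity hE3 ω₂ lam β γ hω hl' hβ' hγ T hT
  unfold TangentBoundAt at H
  refine ⟨a, C, ha, fun N i b hb => ?_⟩
  have ht : 0 ≤ a * (i.val : ℝ) := by positivity
  have H' := H N i b (a * i.val) (Or.inl hb) ht
  simp only [hb, ↓reduceIte] at H'
  have H'' := H' le_rfl
  have hexp : Real.exp (-(κ * ((i.val : ℝ) - a * (i.val : ℝ) / a))) = 1 := by
    rw [show a * (i.val : ℝ) / a = (i.val : ℝ) by field_simp, sub_self, mul_zero, neg_zero, Real.exp_zero]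
  rw [hexp, mul_one, hamiltonian_indep_friction, bondCurrent_indep_friction] at H''
  exact H''

end Summit.AtomisticToContinuum.FouriersLaw.Theorems.ClosedConeSensitivity.Negative.TangentReduction
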